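import Mathlib.Probability.Independence.Integration
import Literature.Probability.Independence.BlackNoiseCriterion
import HarnessLib

/-!
# The first-order Efron–Stein (Bessel) inequality for independent `σ`-algebras

Topic `Literature/Probability/Independence`; pure measure theory (Mathlib only), a companion of
`BlackNoiseCriterion.lean` (Tsirelson's first-chaos calculus). That file proves PARSEVAL for an
element of the first chaos (`integral_sq_eq_sum_of_ae_eq_sum`: if `f = Σᵢ E[f|mᵢ]` then
`∫ f² = Σᵢ ∫ E[f|mᵢ]²`); the present file proves the corresponding BESSEL inequality for an
ARBITRARY square-integrable `f` and pairwise independent sub-`σ`-algebras `m b`: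

* `integral_condExp_mul_condExp_eq_zero_of_indep` — ORTHOGONALITY: for independent `m₁, m₂` and a
  centred `f` (`∫ f = 0`), `∫ E[f|m₁] · E[f|m₂] = 0` (the two conditional expectations are
  independent random variables with mean `∫ f = 0`);
* `sum_integral_condExp_sq_le` — for pairwise independent `m b` (`b` in a finite type) and
  `f ∈ L²` with `∫ f = 0`: **`Σ_b ∫ E[f|m b]² ≤ ∫ f²`** (the centred conditional expectations
  are the orthogonal projections of `f` onto mutually orthogonal subspaces of `L²`, so Bessel
  applies: with `Y = Σ_b E[f|m b]`, `∫ f Y = Σ_b ∫ E[f|m b]² = ∫ Y²`, and Cauchy–Schwarz);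
* `sum_integral_condExp_sub_sq_le` — the same for an arbitrary `f ∈ L²`, centred inside:
  **`Σ_b ∫ (E[f|m b] − ∫ f)² ≤ ∫ (f − ∫ f)²`**, i.e. `Σ_b Var(E[f|m b]) ≤ Var(f)`;
* `iIndep` corollaries `sum_integral_condExp_sq_le_of_iIndep`,
  `sum_integral_condExp_sub_sq_le_of_iIndep`.

This is the first-order part of the Efron–Stein / Hoeffding (ANOVA) decomposition: for
`f = f(X₁, …, Xₙ)` with independent `Xᵢ` and `m b = σ(X_b)`, `E[f|X_b] − E f` is the first-order
Hoeffding component of `f` in direction `b`, these components are orthogonal, and the sum of their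
variances (the numerators of the first-order Sobol indices) is at most `Var f` (Efron–Stein 1981,
ANOVA decomposition, §2; Tsirelson 2003 §6.5, `𝐇₁(f) ≤ ‖f‖²`). Stated for abstract pairwise
independent sub-`σ`-algebras of a probability space, which is how a consumer with a random,
data-dependent family of "regional" `σ`-algebras uses it (crux `KickFairRelEquilibriumMeso` of
`Summits/AtomisticToContinuum/HydrodynamicLimit`, support plan S1 of
`Cruxes/KickFairRelEquilibriumMeso/Lines/kinetic-window-triangle.md`: the non-nested "leak" of a
kick sum into independent regional pasts is Bessel-bounded by the total variance).

Deliberately NOT here: higher-order Hoeffding components, the full Efron–Stein inequality (which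
is `Literature.Probability.Moments.EfronSteinInequality`, product-space form), equality cases.

## References

* B. Efron, C. Stein, *The jackknife estimate of variance*, Ann. Statist. 9 (1981) 586–596, §2
  (ANOVA decomposition). [EfronStein1981]
* B. Tsirelson, *Scaling limit, noise, stability*, LNM 1840 (2004), arXiv:math/0301237, §6.5.
  [Tsirelson2003]
-/

noncomputable section

open _root_.MeasureTheory _root_.ProbabilityTheory Filter Set
open scoped ENNReal

namespace Literature.Probability.Independence

section FirstChaosBessel

variable {Ω : Type*} {mΩ : MeasurableSpace Ω} {μ : Measure Ω}

/-- Random variables measurable for two independent `σ`-algebras are independent. [folklore] -/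
theorem indepFun_of_measurable_of_indep {m₁ m₂ : MeasurableSpace Ω} {β γ : Type*}
    [MeasurableSpace β] [MeasurableSpace γ] {X : Ω → β} {Y : Ω → γ}
    (hX : Measurable[m₁] X) (hY : Measurable[m₂] Y) (h : Indep m₁ m₂ μ) : IndepFun X Y μ := by
  rw [IndepFun_iff_Indep]
  exact indep_of_indep_of_le h hX.comap_le hY.comap_le

/-- **Orthogonality of centred conditional expectations on independent `σ`-algebras**: if
`m₁, m₂ ≤ mΩ` are independent under `μ` and `∫ f = 0`, then `∫ E[f|m₁] · E[f|m₂] dμ = 0`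
(`E[f|m₁]` and `E[f|m₂]` are independent random variables, each of mean `∫ f = 0`). [folklore] -/
theorem integral_condExp_mul_condExp_eq_zero_of_indep [IsFiniteMeasure μ]
    {m₁ m₂ : MeasurableSpace Ω} (hm₁ : m₁ ≤ mΩ) (hm₂ : m₂ ≤ mΩ) (h : Indep m₁ m₂ μ) {f : Ω → ℝ}
    (hf0 : ∫ x, f x ∂μ = 0) :
    ∫ x, (μ[f|m₁]) x * (μ[f|m₂]) x ∂μ = 0 := by
  have h1 : StronglyMeasurable[m₁] (μ[f|m₁]) := stronglyMeasurable_condExp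
  have h2 : StronglyMeasurable[m₂] (μ[f|m₂]) := stronglyMeasurable_condExp
  have hind : IndepFun (μ[f|m₁]) (μ[f|m₂]) μ :=
    indepFun_of_measurable_of_indep h1.measurable h2.measurable h
  rw [hind.integral_fun_mul_eq_mul_integral (h1.mono hm₁).aestronglyMeasurable
    (h2.mono hm₂).aestronglyMeasurable]
  change (∫ x, (μ[f|m₁]) x ∂μ) * ∫ x, (μ[f|m₂]) x ∂μ = 0
  rw [integral_condExp hm₁, hf0, zero_mul]

variable [IsProbabilityMeasure μ] {ι : Type*} [Fintype ι]

/-- **Bessel's inequality for the first chaos (centred form).** For pairwise independent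
sub-`σ`-algebras `m b ≤ mΩ` of a probability space and `f ∈ L²(μ)` with `∫ f = 0`:
`Σ_b ∫ E[f|m b]² dμ ≤ ∫ f² dμ`. Proof: with `Y := Σ_b E[f|m b]`, self-adjointness gives
`∫ f · Y = Σ_b ∫ E[f|m b]² =: T` and orthogonality gives `∫ Y² = T`, so `T ≤ √(∫ f²) · √T` by
Cauchy–Schwarz. [cite: Tsirelson2003, §6.5 (arXiv math/0301237), first chaos] -/
theorem sum_integral_condExp_sq_le {m : ι → MeasurableSpace Ω} (hm : ∀ b, m b ≤ mΩ)
    (hind : Pairwise fun b b' => Indep (m b) (m b') μ) {f : Ω → ℝ} (hf : MemLp f 2 μ)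
    (hf0 : ∫ x, f x ∂μ = 0) :
    ∑ b, ∫ x, (μ[f|m b]) x ^ 2 ∂μ ≤ ∫ x, f x ^ 2 ∂μ := by
  classical
  set g : ι → Ω → ℝ := fun b => μ[f|m b] with hg
  have hgL2 : ∀ b, MemLp (g b) 2 μ := fun b => hf.condExp one_le_two
  have hYL2 : MemLp (fun x => ∑ b, g b x) 2 μ := memLp_finsetSum _ fun b _ => hgL2 b
  -- `T := Σ_b ∫ g_b²`
  set T : ℝ := ∑ b, ∫ x, (g b) x ^ 2 ∂μ with hT
  have hT0 : 0 ≤ T := Finset.sum_nonneg fun b _ => integral_nonneg fun x => sq_nonneg _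
  have hB0 : 0 ≤ ∫ x, f x ^ 2 ∂μ := integral_nonneg fun x => sq_nonneg _
  -- self-adjointness: `∫ f · Y = T`
  have hfY : ∫ x, f x * (∑ b, g b x) ∂μ = T := by
    have hint : ∀ b ∈ (Finset.univ : Finset ι), Integrable (fun x => f x * g b x) μ :=
      fun b _ => hf.integrable_mul (hgL2 b)
    calc ∫ x, f x * (∑ b, g b x) ∂μ = ∫ x, ∑ b, f x * g b x ∂μ := by
          simp_rw [Finset.mul_sum]
      _ = ∑ b, ∫ x, f x * g b x ∂μ := integral_finsetSum _ hint
      _ = T := Finset.sum_congr rfl fun b _ => by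
          rw [hg]
          simp only
          rw [integral_mul_condExp_eq (hm b) hf hf]
          exact integral_congr_ae (Eventually.of_forall fun x => by simp [sq])
  -- orthogonality: `∫ Y² = T`
  have hYY : ∫ x, (∑ b, g b x) ^ 2 ∂μ = T := by
    have hint : ∀ b ∈ (Finset.univ : Finset ι),
        Integrable (fun x => g b x * ∑ b', g b' x) μ := fun b _ => (hgL2 b).integrable_mul hYL2
    have hdiag : ∀ b, ∫ x, g b x * (∑ b', g b' x) ∂μ = ∫ x, (g b) x ^ 2 ∂μ := by
      intro b
      have hint' : ∀ b' ∈ (Finset.univ : Finset ι), Integrable (fun x => g b x * g b' x) μ :=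
        fun b' _ => (hgL2 b).integrable_mul (hgL2 b')
      calc ∫ x, g b x * (∑ b', g b' x) ∂μ = ∫ x, ∑ b', g b x * g b' x ∂μ := by
            simp_rw [Finset.mul_sum]
        _ = ∑ b', ∫ x, g b x * g b' x ∂μ := integral_finsetSum _ hint'
        _ = ∫ x, g b x * g b x ∂μ := by
            refine Finset.sum_eq_single b (fun b' _ hb' => ?_) (fun hb => absurd (Finset.mem_univ b) hb)
            rw [hg]
            exact integral_condExp_mul_condExp_eq_zero_of_indep (hm b) (hm b') (hind hb'.symm) hf0
        _ = ∫ x, (g b) x ^ 2 ∂μ := integral_congr_ae (Eventually.of_forall fun x => by simp [sq])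
    calc ∫ x, (∑ b, g b x) ^ 2 ∂μ = ∫ x, ∑ b, g b x * ∑ b', g b' x ∂μ := by
          refine integral_congr_ae (Eventually.of_forall fun x => ?_)
          simp only [sq, Finset.sum_mul]
      _ = ∑ b, ∫ x, g b x * ∑ b', g b' x ∂μ := integral_finsetSum _ hint
      _ = T := Finset.sum_congr rfl fun b _ => hdiag b
  -- Cauchy–Schwarz: `T = ∫ f Y ≤ √(∫ f²) √(∫ Y²) = √(∫ f²) √T`
  have hle : T ≤ √(∫ x, f x ^ 2 ∂μ) * √T :=
    calc T = ∫ x, f x * (∑ b, g b x) ∂μ := hfY.symm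
      _ ≤ |∫ x, f x * (∑ b, g b x) ∂μ| := le_abs_self _
      _ ≤ √(∫ x, f x ^ 2 ∂μ) * √(∫ x, (∑ b, g b x) ^ 2 ∂μ) :=
          abs_integral_mul_le_sqrt_mul_sqrt hf hYL2
      _ = √(∫ x, f x ^ 2 ∂μ) * √T := by rw [hYY]
  exact le_of_sqrt_mul_sqrt_le hT0 hB0 hle

/-- **Bessel's inequality for the first chaos / first-order Efron–Stein.** For pairwise
independent sub-`σ`-algebras `m b ≤ mΩ` of a probability space and `f ∈ L²(μ)`:
`Σ_b ∫ (E[f|m b] − ∫ f)² dμ ≤ ∫ (f − ∫ f)² dμ`, i.e. `Σ_b Var(E[f | m b]) ≤ Var(f)` — the sum of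
the variances of the first-order Hoeffding components is at most the total variance.
[cite: EfronStein1981, §2 (ANOVA decomposition, first-order terms)] -/
theorem sum_integral_condExp_sub_sq_le {m : ι → MeasurableSpace Ω} (hm : ∀ b, m b ≤ mΩ)
    (hind : Pairwise fun b b' => Indep (m b) (m b') μ) {f : Ω → ℝ} (hf : MemLp f 2 μ) :
    ∑ b, ∫ x, ((μ[f|m b]) x - ∫ y, f y ∂μ) ^ 2 ∂μ ≤ ∫ x, (f x - ∫ y, f y ∂μ) ^ 2 ∂μ := by
  set c : ℝ := ∫ y, f y ∂μ with hc
  -- centre: `F := f − c`, `∫ F = 0`, `E[F|m b] = E[f|m b] − c` a.e.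
  have hfi : Integrable f μ := hf.integrable one_le_two
  have hF : MemLp (fun x => f x - c) 2 μ := hf.sub (memLp_const c)
  have hF0 : ∫ x, f x - c ∂μ = 0 := by
    rw [integral_sub hfi (integrable_const c), integral_const, probReal_univ, one_smul, ← hc, sub_self]
  have hFb : ∀ b, μ[(fun x => f x - c)|m b] =ᵐ[μ] fun x => (μ[f|m b]) x - c := by
    intro b
    have h := condExp_sub hfi (integrable_const c) (m b)
    rw [show (f - fun _ : Ω => c) = (fun x => f x - c) from rfl] at h
    filter_upwards [h] with x hx
    rw [hx, Pi.sub_apply, condExp_const (hm b) c]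
  have key := sum_integral_condExp_sq_le hm hind hF hF0
  calc ∑ b, ∫ x, ((μ[f|m b]) x - c) ^ 2 ∂μ
      = ∑ b, ∫ x, (μ[(fun x => f x - c)|m b]) x ^ 2 ∂μ := Finset.sum_congr rfl fun b _ => by
          refine integral_congr_ae ?_
          filter_upwards [hFb b] with x hx
          rw [hx]
    _ ≤ ∫ x, (f x - c) ^ 2 ∂μ := key

/-- `iIndep` form of `sum_integral_condExp_sq_le` (a mutually independent family is pairwise
independent). [folklore] -/
theorem sum_integral_condExp_sq_le_of_iIndep {m : ι → MeasurableSpace Ω} (hm : ∀ b, m b ≤ mΩ)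
    (hind : iIndep m μ) {f : Ω → ℝ} (hf : MemLp f 2 μ) (hf0 : ∫ x, f x ∂μ = 0) :
    ∑ b, ∫ x, (μ[f|m b]) x ^ 2 ∂μ ≤ ∫ x, f x ^ 2 ∂μ :=
  sum_integral_condExp_sq_le hm (fun _ _ hbb' => hind.indep hbb') hf hf0

/-- `iIndep` form of `sum_integral_condExp_sub_sq_le`: `Σ_b Var(E[f | m b]) ≤ Var(f)` for a
mutually independent finite family of sub-`σ`-algebras. [folklore] -/
theorem sum_integral_condExp_sub_sq_le_of_iIndep {m : ι → MeasurableSpace Ω}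
    (hm : ∀ b, m b ≤ mΩ) (hind : iIndep m μ) {f : Ω → ℝ} (hf : MemLp f 2 μ) :
    ∑ b, ∫ x, ((μ[f|m b]) x - ∫ y, f y ∂μ) ^ 2 ∂μ ≤ ∫ x, (f x - ∫ y, f y ∂μ) ^ 2 ∂μ :=
  sum_integral_condExp_sub_sq_le hm (fun _ _ hbb' => hind.indep hbb') hf

end FirstChaosBessel

end Literature.Probability.Independence

end
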